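import Summits.BirchSwinnertonDyer.Rank1Residual.O5.O5UncleanParity
import Summits.BirchSwinnertonDyer.Rank1Residual.Additive.FouquetWanLocus
import HarnessLib

/-!
# O5 at `p = 3` — T26 FOUQUET (2025) CONGRUENCE TRANSPORT ON THE O5 WEBS
# (cell `b2b-bsdres`, lane CLASS-CLOSURE, team o5, planner o5-r1 GEN 9 — TYPED, NOTHING ASSERTED)

HONEST FRAMING (cell `b2b-bsdres`, verbatim): the goal of the cell is to DELETE the COMBINATION-SHAPED
residual classes of the BSD formula for all analytic-rank `≤ 1` curves over `ℚ` from PUBLISHED theorems,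
so that the remainder is exactly the CONSTRUCTION-SHAPED classes, which are TYPED, not attempted.  Lane
CLASS-CLOSURE: census output is EVIDENCE / conjecture items, never a Literature fact; no main conjecture
inside any certificate; nothing is booked here and no mark of `RESIDUAL-MAP.md` moves.

## What this file types (experiment type (3) "transport search" + (2) "obstruction anatomy" for O5@3, r0)

**T26 (T-O5-F25).**  Fouquet, *Tunis. J. Math.* 7 (2025) 791–829, Thm 4.1 (1)⇒(2) and Thm 1.7 (2)
[bib `Fouquet2025EquivariantTNC`; printed for `p ≥ 3`; at `p = 3` its Thm 2.10 input is the Colmez–Wang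
PREPRINT arXiv:2104.09200v2 — an INPUT FLAG carried, not discharged (lit S-g54-3: "PUB* flagged")]:
for `ρ̄ = W[3]` with (A) `im ρ̄ ⊇ SL₂(𝔽₃)` (Ass. 2.9 (1)), (B) `ρ̄|G_{ℚ₃}` irreducible (⟺ Ass. 2.9 (2) for
elliptic curves at 3, harvest E87 §2.2) and (C) Ass. 3.4 on the level-raising primes
`LR(W) = {ℓ ∥ N_W, ℓ ≠ 3 : 3 ∣ v_ℓ(Δ_W)}` (`2 ∉ LR`; `ℓ ≡ 1 (3)` needs `u_ℓ = Δ_W ℓ^{-v}` a non-cube mod `ℓ`;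
E87 §2.3–2.4), the Iwasawa main conjecture in Kato's zeta-element form moves along a mod-3 congruence
from ANY motivic point `G` of the Hecke algebra `T^Σ_{𝔪ρ̄}` (`G[3] ≅ W[3]`, prime-to-3 level inside `Σ =
primes(3N_W)`) to `W`; and at an analytic-rank-0 point Thm 1.7 (2) outputs TNC₃(h¹(W)(1)) directly, whence
the 3-part of BSD (Kings 2011 Lect. 3 Thm 3 (5), harvest E19.2).  Typed below as TWO HYPOTHESIS SHAPES over
the interface `KMC` (Kato Conj. 12.10, as everywhere in this directory): `FouquetCongruenceTransportShapeThree`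
(IMC transport) and `FouquetCongruenceBSDShapeThree` (rank-0 output in Miller's currency `MissingPPartAt W 3`),
plus the SEED SHAPE `UnitSupersingularSeedShapeThree` ((D♮): good supersingular rank-0 `G` with
`3 ∤ #Ш_an(G)·∏c_ℓ(G)·#G(ℚ)_tors` and `ρ_{G,3^∞}` onto ⇒ `KMC G 3`; chain of PUBLISHED statements Kato Thm 12.5
(1)(2)(4) + 12.4 (3), reading harvest E87 §3 — a check unit is requested, so it is a SHAPE, not a theorem of
record) and the kernel assembly `missingPPartAt_three_of_fouquet_of_unitSeed`.

**T26b (THEOREM over T25♯, kernel-checked here): the Ш-defect web carries no unit seed.**  From GEN 8's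
`SelmerDisparityBudgetThree` (T25♯): a LOWER-9 TIDY row `W` (`dim Sel₃(W) ≥ 2`, no prime `ℓ ≠ 3` with
`3 ∣ c_ℓ(W)`) has NO congruent O5 companion `G` with `Sel₃(G) = 0` and no transverse prime — the budget of such
a pair is the class bit `≤ 1` (`disparityBudgetThree_le_one_of_noTransverse`,
`selmerDimThree_ne_zero_of_lowerNineTidy_companion`).  So unit-seed transport serves the UNIT and
TAMAGAWA-DEFECT webs only; the Ш-defect (LOWER-9) webs need an IMC-grade seed (printed IMC for a charged
companion — all PRE at `p = 3`: Wan / CÇSS arXiv:1804.10993 / BSTW arXiv:2409.01350) or T-O5-A itself.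

## Census P-K15 (pre-registered `gen9/P-K15-PREREG.md` sha16 `a5a5973c6071d58f`; script `gen9/pk15/pk15.py`
v1.1 sha16 `1452c2daeec4857a`, 65 s, zero kit; EVIDENCE only)

Universe: the 12 732 O5@3 rank-0 cells of `class-closure/O5/pairs-openA-R203.tsv` (X4 10 158, X3 2 574);
companions: cc-eng-2 CONG links (p = 3) minus strike lists, re-screened at good `ℓ ≤ 97` (214 779 kept).
X4 OPEN at R203 (2 769 rows) by lane × defect class (UNIT / TAM = `3 ∣ ∏c`, Ш unit / LOWER9 = `9 ∣ Ш_an`,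
`∏c` unit / BOTH):  OUT(A) `im ≠ GL₂` 246 · OUT(B) `¬LocIrr` 1 167 · OUT(C) 307 (LR2 283, LR1cube 29) ·
NOSEED 62 · **ROAD-nat 79** (UNIT 46, TAM 32, BOTH 1; all III*) · **ROAD-add 343** (UNIT 92, TAM 203, BOTH 48;
additive potentially-good unit seed, Manin binder) · ROAD?lvl 4 · LINK (eligible, every companion charged) 561
(LOWER9 509, TAM 39, BOTH 13) — **LOWER9: 0 ROAD rows of 1 148; 0 unit companions of any reduction type on
the 623 LocIrr-surj LOWER9 rows (2 466 companions, all charged)** = K1 PASS (predicted 0).  Control X4 CLOSED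
(7 389): ROAD-nat 234, ROAD-add 1 669.  K2 (local consistency under congruence) 0 violations; K3 (LocIrr by
`Ψ₃`-roots = valuation criterion `LocIrrCriterionThree`) 0 mismatches on 12 732; K4 (typing) 0 exceptions.
Unregistered observation K5: on all 12 979 (W, unit tame/gss G) pairs the GEN-8 budget `d(W,G)` is EVEN
(UNIT rows d = 0 ×5 187; TAM d = 2 ×7 549, d = 4 ×1; BOTH d = 2 ×242) — T25 parity with `s(W) ≡ s(G) ≡ 0`.

Nothing here is a Literature fact; every `def … : Prop` is a hypothesis SHAPE or a census predicate; the two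
theorems are bookkeeping over explicit hypotheses.

## TYPER PLACEMENT NOTE (cc-typer-5 GEN 10, typer of record O5 §3.5, 2026-08-21; ask A-O5-22)

HONEST FRAMING (cell `b2b-bsdres`, run/shared/lean/b2b/bsd-rank1-residual/, verbatim in every file): the goal of
the cell is to DELETE the COMBINATION-SHAPED residual classes of the Birch–Swinnerton-Dyer formula for ALL
analytic-rank `≤ 1` elliptic curves over `ℚ` — assembled STRICTLY from published theorems — so that the rank-`≤ 1`
remainder becomes exactly the CONSTRUCTION-SHAPED classes, which are TYPED (missing-input `Prop`s), NOT attempted.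
This is not "finishing BSD". Lane CLASS-CLOSURE (`CLASS-CLOSURE-PLAN.md` §3.5 O5; experiment types (3) TRANSPORT
SEARCH — a level-lowering / level-raising CONGRUENCE transport with its printed antecedent (Fouquet 2025 Thm 4.1 /
Thm 1.7, Kato 2004 Conj. 12.10 / Thm 12.4–12.5), each stated as the exact COMPARISON STATEMENT it needs — and (2)
OBSTRUCTION ANATOMY — the census columns (A) image, (B) `LocIrr`, (C) Ass. 3.4, (D♮) seed, level, sub-partitioning the
open O5@3 rank-0 residue): research routes; no claim beyond the stated classes; census output is EVIDENCE /
conjecture items with a PRE-REGISTERED prediction (P-K15, `gen9/P-K15-PREREG.md` sha16 `a5a5973c6071d58f`, registered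
BEFORE the run), never a Literature fact; no main conjecture inside any certificate; nothing is booked; no mark of
`RESIDUAL-MAP.md` moves. NO Literature fact is minted here: the three SHAPES are `Prop`-valued functions of the
interface variable `KMC` consumed ONLY as explicit hypotheses (exactly as `FouquetWanClaimShape KMC` in
`Additive/FouquetWanLocus.lean`), the three census predicates have bodies; the audit files every untagged
`def : Prop` under 'vendored-fact' and the four theorems as 'orphan' until a consumer imports them — nothing is
assumed about any of them (o5-r1: "no `@[conjecture]` needed"; the typer concurs: a tag marks a CLOSED obligation
node, and these are open-parameter hypothesis shapes like their `FouquetWanLocus` precedent).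

PROVENANCE. The module text above this note and every declaration below are o5-r1 GEN 9's draft
`HOME/b2b-bsdres-o5-r1/gen9/O5FouquetTransport.lean` (sha16 `e55af8a0435fada3`, 204 lines, farm rc 0 / 0 warnings;
`HOME/INBOX.md` o5-r1 GEN 9 line 2026-08-21T19:13Z, ask A-O5-22; write-up `gen9/T26-FOUQUET-TRANSPORT.md` sha16
`f46f9c8a9176153f`; readings harvest-2 E87 `HOME/b2b-bsdres-harvest-2/gen40/E87-Q-O6-G9-2-Fouquet2025.md` sha16
`fb728c9f90c8a409`), with EVERY declaration's statement and body BYTE-IDENTICAL; the only typer changes are this note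
and two docstring precisions: (i) Kato's page locators aligned with the printed pages and the tree's 500+ existing
cites — Thm. 12.4 p. 221, Thm. 12.5 pp. 221–222 (the draft had "p. 229"), Conj. 12.10 p. 224 [corpus:
paper:doi-10-24033-ast-639 p0106–p0107, p0109 = printed pp. 221–222, 224]; (ii) the seed shape's pending check unit is
harvest-2's **F-T26-4** (o5-r1's own INBOX line), not "A-O5-21" (that id is the typer's T24ℓ offer,
`O5/O5KummerLineLocalSign.lean`). Locators checked against the held text of [Fouquet2025EquivariantTNC] = arXiv
2501.07105v1 [corpus: paper:arxiv-2501.07105 — Ass. 3.4 p0022 L42–p0023 L14 ("if `ℓ ∤ p` belongs to `Σ∖Σ(ρ̄)` then it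
is odd and one of the following holds …"; (5)(a)(b)(c) at `ℓ ≡ 1 (p)` with `ρ̄|I_ℓ` scalar), Prop. 3.5 p0023 L16, Thm.
4.1 p0024 L47, Thm. 1.7 p0007 L16]. DEDUP re-run by the typer (tree grep on all 10 new names: no match); vocabulary
reused, not re-declared: the tree Predicates `ClassX4` / `ClassO5` / `ClassO6` / `LocIrr`, GEN 7's `IsCongruentModThree`,
GEN 8's `transversePrimesThree` / `crossBitThree` / `disparityBudgetThree` / `selmerDimThree` / T25♯
`SelmerDisparityBudgetThree` (`O5/O5UncleanParity.lean`), `PotSupersingularLowerHalfRankZeroOfKMC`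
(`Additive/FouquetWanLocus.lean`), Literature's `MissingPPartAt` / `MissingLowerBoundAt` (Miller's currency),
`Kato2004.ImageContainsSL2`, `shaAn`, `HasSurjectiveModNGaloisRep`, `minimalDiscriminantInt`, `conductorNorm`. Every
`[cite: …]` key is in `references.bib` (Fouquet2025EquivariantTNC — PUBLISHED Tunis. J. Math. 7 (2025), text held =
arXiv v1; Kato2004Asterisque; Miller2011LMS — checked).

CHECK STATUS at landing. o5-r1's check unit for THIS file is **F-T26-4** (harvest-2: E87 §3's (D♮) unit-supersingular
seed chain at `p = 3` line by line — Kato Thm 12.4 (3) freeness, Thm 12.5 (1)(2)(4), the unit pinning — and whether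
Thm 4.1 tolerates `Σ`-enlargement as the census column `enl-ok` uses it), requested in the same INBOX line and NOT yet
delivered; until it is, `UnitSupersingularSeedShapeThree` is a SHAPE (hypothesis), as the draft says, and nothing below
changes if F-T26-4 returns precisions (doc-only amendment then). Author-facing question OPEN (o5-r1 GEN 9 addendum 2):
whether "odd" in Ass. 3.4 is used beyond Shotton's `R_ℓ` computation — 283 OUT(C) rows die only at `ℓ = 2`; the typed
predicate `FouquetEligibleThree` keeps `q ≠ 2` AS PRINTED. F-T26-1 (cc-eng-2 successor: Sturm certification of the
422 + 1 903 ROAD congruences) would upgrade screen-grade pairs to certified instances of the assembly theorem's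
hypotheses `hcong`; no statement here depends on it.
-/

set_option autoImplicit false

open WeierstrassCurve Literature.NumberTheory.EllipticCurves
  Literature.NumberTheory.EllipticCurves.Rank1Residual
  Literature.NumberTheory.EllipticCurves.Rank1Residual.Typed
  Summit.BirchSwinnertonDyer.Rank1Residual.Additive

namespace Summit.BirchSwinnertonDyer.Rank1Residual.O5

/-! ## §1 Census predicates: Fouquet eligibility (C), level compatibility, the unit supersingular seed (D♮) -/

/-- **(C) Fouquet's Ass. 3.4 at `p = 3` on the level-raising primes of `W`** (E87 §2.3–2.4, reading of
[cite: Fouquet2025EquivariantTNC, Ass. 3.4 (p. 22–23) and Prop. 3.5]): at every prime `q ≠ 3` of multiplicative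
reduction where `W[3]` is UNRAMIFIED (`3 ∣ v_q(Δ_min)`, Tate): `q` is odd, and if `q ≡ 1 (mod 3)` then
`u_q := Δ_min · q^{-v_q(Δ_min)}` is NOT a cube mod `q` ((5b); (5a) fails and (5c) admits no Steinberg point,
E87 §2.4 via Shotton Prop. 5.8 (3)); `q ≡ 2 (mod 3)` is (3b) with Iwahori level, automatic.  Census column
`C` of P-K15 (X4 OPEN LocIrr surj: 307 rows fail — 283 at `q = 2`, 29 by a cube). A predicate; nothing asserted.
[cite: Fouquet2025EquivariantTNC, Ass. 3.4] -/
def FouquetEligibleThree (W : WeierstrassCurve ℚ) [W.IsGloballyMinimal] : Prop :=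
  ∀ (q : ℕ) [Fact q.Prime], q ≠ 3 → W.HasMultiplicativeReductionAtPrime q →
    3 ∣ padicValInt q W.minimalDiscriminantInt →
      q ≠ 2 ∧ (q % 3 = 1 →
        ¬ ∃ x : ZMod q, x ^ 3 =
          ((W.minimalDiscriminantInt / (q : ℤ) ^ padicValInt q W.minimalDiscriminantInt : ℤ) : ZMod q))

/-- **Level compatibility of the seed (strict form, `Σ = primes(3·N_W)`):** every prime `q ≠ 3` of bad
reduction of `G` divides `N_W` (so `G` is a point of `T^Σ_{𝔪ρ̄}` without enlarging `Σ`; E87 §5.2 "prime-to-p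
level dividing that of `U^{(p)}`").  Census column `lvl = sub` (71 914 of 214 779 companions; enlarging `Σ`
re-imposes Ass. 3.4 at the new primes — column `enl-ok`, 67 746). [cite: Fouquet2025EquivariantTNC, §3.1 and Thm 4.1] -/
def FouquetLevelCompatibleThree (W G : WeierstrassCurve ℚ) [W.IsElliptic] [G.IsElliptic] : Prop :=
  ∀ q : ℕ, q.Prime → q ≠ 3 → (q : ℤ) ∣ G.conductorNorm ℤ → (q : ℤ) ∣ W.conductorNorm ℤ

/-- **(D♮) unit supersingular seed at 3**: `G` has good SUPERSINGULAR reduction at `3` (`a₃(G) ≡ 0`),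
analytic rank `0`, `3 ∤ #Ш_an(G)` (a rational number of 3-adic valuation `0`), `3 ∤ ∏_ℓ c_ℓ(G)`,
`3 ∤ #G(ℚ)_tors`, and `ρ_{G,3^n}` onto for all `n` (census: surjective mod 3 + a `j`-witness prime, the tree's
`hasSurjectiveModNGaloisRep_pow_of_surj_of_jWitness` lever).  Census predicate `unit♮ ∧ tower` of P-K15.
[folklore] -/
def IsUnitSupersingularSeedThree (G : WeierstrassCurve ℚ) [G.IsElliptic] [G.IsGloballyMinimal] : Prop :=
  G.HasGoodReductionAtPrime 3 ∧ ((G.LFunction 3 : ℤ) : ZMod 3) = 0 ∧ G.analyticRank = 0 ∧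
    (∃ q : ℚ, shaAn G = (q : ℂ) ∧ padicValRat 3 q = 0) ∧ ¬ 3 ∣ G.tamagawaProduct ∧ ¬ 3 ∣ G.torsionOrder ∧
    ∀ n : ℕ, G.HasSurjectiveModNGaloisRep (3 ^ n : ℕ)

/-! ## §2 The hypothesis SHAPES over the interface `KMC` (PUB* at `p = 3`: consumed only as explicit hypotheses) -/

section Shapes

variable (KMC : ∀ (W : WeierstrassCurve ℚ) [W.IsElliptic] [W.IsGloballyMinimal] (p : ℕ), Prop)

/-- **T26 SHAPE A — Fouquet Thm 4.1 (1)⇒(2) at `p = 3` along a mod-3 congruence (IMC transport).**  For `W`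
additive at `3` with `W[3]` irreducible (X4), `ρ̄_{W,3}` onto, `W[3]|G_{ℚ₃}` irreducible, Ass. 3.4 on `LR(W)`,
and a level-compatible elliptic point `G` of the same Hecke algebra (`a_ℓ(W) ≡ a_ℓ(G)` at all good `ℓ`):
`KMC G 3 → KMC W 3`.  PUB* (Colmez–Wang input flag at 3); the identification "Kato Conj. 12.10 for `f_G` ⟺
conj. 2.7 for `T(f_G)_Iw`" is the formulation joint J-F25 (E87 §5.2).  NOT a theorem of record, NOT a
Literature fact. [cite: Fouquet2025EquivariantTNC, Thm 4.1 and Thm 1.7] [cite: Kato2004Asterisque, Conj. 12.10 (p. 224)] -/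
def FouquetCongruenceTransportShapeThree : Prop :=
  ∀ (W G : WeierstrassCurve ℚ) [W.IsElliptic] [W.IsGloballyMinimal] [G.IsElliptic] [G.IsGloballyMinimal],
    ClassX4 W 3 → W.HasSurjectiveModNGaloisRep 3 → LocIrr W 3 → FouquetEligibleThree W →
    IsCongruentModThree W G → FouquetLevelCompatibleThree W G → KMC G 3 → KMC W 3

/-- **T26 SHAPE B — the rank-0 output (Thm 1.7 (2), second sentence: "if in addition `L(f,χ,r) ≠ 0`, then
conjecture 1.1 for `W(λ)` at `p` holds", + Kings 2011 Lect. 3 Thm 3 (5): TNC₃ ⇒ BSD₃).**  Same hypotheses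
plus `r_an(W) = 0`: `KMC G 3 → MissingPPartAt W 3` (the 3-part of `#Ш` in Miller's currency).  This BYPASSES the
additive descent (d1) of T-O5-A for rank 0.  PUB* as Shape A. [cite: Fouquet2025EquivariantTNC, Thm 1.7 (2)]
[cite: Miller2011LMS, Def. 1.1] -/
def FouquetCongruenceBSDShapeThree : Prop :=
  ∀ (W G : WeierstrassCurve ℚ) [W.IsElliptic] [W.IsGloballyMinimal] [G.IsElliptic] [G.IsGloballyMinimal],
    W.analyticRank = 0 → ClassX4 W 3 → W.HasSurjectiveModNGaloisRep 3 → LocIrr W 3 →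
    FouquetEligibleThree W → IsCongruentModThree W G → FouquetLevelCompatibleThree W G →
    KMC G 3 → MissingPPartAt W 3

/-- **SEED SHAPE (D♮) — a unit supersingular seed satisfies Kato's main conjecture at 3.**  Chain of
PUBLISHED statements as read by harvest E87 §3 (Kato Thm 12.4 (3) freeness for `p ≠ 2`, `T/𝔪` irreducible;
Thm 12.5 (1)(2)(4) one divisibility under `ρ_{G,3^∞}` onto; the unit value `3 ∤ L(G,1)/Ω_G` — i.e.
`3 ∤ #Ш_an·∏c·#tors^{-2}` — pins both sides to units).  A SHAPE pending its own check unit (F-T26-4, harvest-2;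
GEN 10 precision: the draft's "(A-O5-21)" is the typer's T24ℓ offer id), not a theorem of record.
[cite: Kato2004Asterisque, Thm. 12.4 (3) (p. 221), Thm. 12.5 (pp. 221–222) and Conj. 12.10 (p. 224)] -/
def UnitSupersingularSeedShapeThree : Prop :=
  ∀ (G : WeierstrassCurve ℚ) [G.IsElliptic] [G.IsGloballyMinimal], IsUnitSupersingularSeedThree G → KMC G 3

/-- **Kernel assembly of the ROAD-nat lane (bookkeeping; every conjectural / PUB* input an explicit
hypothesis).**  Shape B + the seed shape + the census columns (A)(B)(C)(D♮, level) of a pair `(W, G)` ⇒ the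
3-part of BSD for the rank-0 O5 row `W`.  P-K15: 79 X4-OPEN rows (76 with a strict sub-level seed) and 234
X4-CLOSED rows have such a pair OF RECORD AT SCREEN GRADE (`ℓ ≤ 97`; a typed instance needs the congruence at
all `ℓ` — Sturm certificate, cc-eng-2's 2ENG device). [folklore] -/
theorem missingPPartAt_three_of_fouquet_of_unitSeed (hF : FouquetCongruenceBSDShapeThree KMC)
    (hS : UnitSupersingularSeedShapeThree KMC)
    (W G : WeierstrassCurve ℚ) [W.IsElliptic] [W.IsGloballyMinimal] [G.IsElliptic] [G.IsGloballyMinimal]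
    (hr : W.analyticRank = 0) (hX : ClassX4 W 3) (hρ : W.HasSurjectiveModNGaloisRep 3) (hirr : LocIrr W 3)
    (helig : FouquetEligibleThree W) (hcong : IsCongruentModThree W G)
    (hlev : FouquetLevelCompatibleThree W G) (hseed : IsUnitSupersingularSeedThree G) :
    MissingPPartAt W 3 :=
  hF W G hr hX hρ hirr helig hcong hlev (hS G hseed)

/-- **Shape A feeds the shared descent shell (as the FW locus does in `Additive/FouquetWanLocus.lean`).**
Transport of `KMC` to `W` + `PotSupersingularLowerHalfRankZeroOfKMC KMC` (T-O5-A (d1), conjecture shell) ⇒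
the r0 LOWER half `MissingLowerBoundAt W 3` — the route for RANK-0 rows if one prefers Kato's 12.10 currency to
Thm 1.7 (2)'s TNC sentence, and the only route Shape A offers toward rank 1. Nothing credited.
[cite: Fouquet2025EquivariantTNC, Thm 4.1] [cite: Kato2004Asterisque, Conj. 12.10 (p. 224)] -/
theorem missingLowerBoundAt_three_of_fouquetTransport_of_shared
    (hA : FouquetCongruenceTransportShapeThree KMC) (hshared : PotSupersingularLowerHalfRankZeroOfKMC KMC)
    (W G : WeierstrassCurve ℚ) [W.IsElliptic] [W.IsGloballyMinimal] [G.IsElliptic] [G.IsGloballyMinimal]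
    (hO : ClassO5 W 3 ∨ ClassO6 W 3) (hX : ClassX4 W 3) (hρ : W.HasSurjectiveModNGaloisRep 3)
    (hirr : LocIrr W 3) (helig : FouquetEligibleThree W) (hcong : IsCongruentModThree W G)
    (hlev : FouquetLevelCompatibleThree W G) (hG : KMC G 3) (himg : Kato2004.ImageContainsSL2 W 3)
    (hL : W.entireLFunction 1 ≠ 0) (hfin : Finite W.sha) : MissingLowerBoundAt W 3 :=
  hshared W hO himg (hA W G hX hρ hirr helig hcong hlev hG) hL hfin

end Shapes

/-! ## §3 T26b — the Ш-defect web carries no unit seed (PROVED over the GEN-8 budget law T25♯) -/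

/-- With no transverse prime on either side the typed disparity budget is the class bit, hence `≤ 1`.
[folklore] -/
theorem disparityBudgetThree_le_one_of_noTransverse (W X : WeierstrassCurve ℚ) [W.IsElliptic]
    [W.IsGloballyMinimal] [X.IsElliptic] [X.IsGloballyMinimal] (hW : transversePrimesThree W = ∅)
    (hX : transversePrimesThree X = ∅) : disparityBudgetThree W X ≤ 1 := by
  have h0 : disparityBudgetThree W X = crossBitThree W X := by
    unfold disparityBudgetThree
    rw [hW, hX]
    simp
  have h1 : crossBitThree W X ≤ 1 := by
    unfold crossBitThree
    split <;> omega
  omega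

/-- **T26b.**  GIVEN T25♯ `SelmerDisparityBudgetThree` (GEN 8; evidence 80 386 / 80 386 pairs): a LOWER-9
TIDY O5 row `W` at `3` (`dim_{𝔽₃} Sel₃(W) ≥ 2` — e.g. rank 0 with `9 ∣ #Ш`, by Cassels–Tate `Ш[3] ≅ (ℤ/3)^{2k}`
— and no prime `ℓ ≠ 3` with `3 ∣ c_ℓ(W)`), locally irreducible at `3` with `W[3]` irreducible, admits NO
congruent O5 companion `G` with `Sel₃(G) = 0` and no transverse prime: a unit seed would force
`2 ≤ dim Sel₃(W) ≤ 0 + budget ≤ 1`.  Census P-K15 K1: 0 unit companions (tame, good supersingular OR wild)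
on the 623 LocIrr-surj LOWER9 rows (2 466 companions, all charged) — the typed statement covers the tame
companions; the gss / wild ones are the reduction-free form T25♭.  B-FACING: Fouquet's unit-seed transport
cannot reach the Ш-defect class; it serves UNIT / TAM-defect rows. [folklore] -/
theorem selmerDimThree_ne_zero_of_lowerNineTidy_companion (hT25 : SelmerDisparityBudgetThree)
    (W G : WeierstrassCurve ℚ) [W.IsElliptic] [W.IsGloballyMinimal] [G.IsElliptic] [G.IsGloballyMinimal]
    (h5W : ClassO5 W 3) (h5G : ClassO5 G 3) (hirr : LocIrr W 3) (hIrr : W.HasIrreducibleModPGaloisRep 3)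
    (hcong : IsCongruentModThree W G) (hW : transversePrimesThree W = ∅)
    (hG : transversePrimesThree G = ∅) (hsW : 2 ≤ selmerDimThree W) : selmerDimThree G ≠ 0 := by
  intro h0
  have hle := hT25 W G h5W h5G hirr hIrr hcong
  have hb := disparityBudgetThree_le_one_of_noTransverse W G hW hG
  omega

end Summit.BirchSwinnertonDyer.Rank1Residual.O5
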